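import Literature.MathematicalPhysics.QuantumFieldTheory.Balaban1983to89.B3Op116MajorantConvolution
import Literature.MathematicalPhysics.QuantumFieldTheory.Balaban1983to89.B3Op116KernelRegularTorus

/-!
# Bałaban, *(Higgs)₂,₃ quantum fields in a finite volume III. Renormalization* [B3] — the kernel of (1.16) p. 414: ONE STEP
`w ↦ G_k(T_ε,X)V_k(A,B)w` IN THE (2.6)/(2.10) MAJORANT CURRENCY (FILE 4β₁ of the cell's programme for the analytic half of (1.16)):
if the values of `w` are majorised with exponent `a_v` and its covariant derivatives with exponent `a_v − 1` (anchored at the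
source `x′`), then every row of `G_kV_kw` against a kernel majorised with exponent `a_K` (`κ_X`: `a_K = 2`; `κ^D_{B,X}`: `a_K = 1`)
is majorised with exponent `a_K + a_v − 1` — pure lattice bookkeeping on r14's FILE E and p33's closure under convolution

statement-level skeleton of published theorems with citation tags; proofs where landed; nothing here is a claim about the Yang–Mills mass gap

T. Bałaban, Commun. Math. Phys. **88** (1983) 411–445 [cite: Balaban1983Higgs3]; part I, Commun. Math. Phys. **85** (1982) 603–636
[cite: Balaban1982Higgs1].  PDFs held: `paper:balaban1983-higgs-2-3-quantum-fields-finite-volume` (journal page = PDF page + 410;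
p. 414 = `p0004.txt`, p. 424 = `p0014.txt`, p. 426 = `p0016.txt`).

CITATION HEADER (lean-in-tree rule).  Cell `lit-balaban` (HOME `run/shared/lean/pub/lit-balaban/`), proof seat **p35** gen 22
(unit `lit-balaban-p35`); TAKING line HOME/STATUS 2026-08-23T05:03:06Z (FILE 4α/4β); design `lit-balaban-p35/DESIGN-FILE4.md` §9(c),
master design `lit-balaban-r14/DESIGN-B3-116-analytic.md` §2/§4.  SKELETON row **B3.Eq1.16 (analytic half)** (fold owner r15) —
LOCATED ENGINE, no head claim; decl of record `B3Sect2StatementsPart2.ScaledKernels.Ineq25At` (r15).  Programme files: FILE E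
`B3Op116ScaleChains` (r14 ✓), `B3Op116MajorantConvolution` (p33 ✓: `sum_kernel_mul_le`, `sum_bond_kernel_mul_le`, `majorant_le_top`),
FILE 3(b) `B3Op116KernelRegularTorus` (r14 ✓: `majorant_shift_le`, `sum_block_exp_le`), FILE 4α `B3Op116LeibnizRows` (p35: the rows this
step consumes), FILE 4β₂ `B3Op116DKernelRegularTorus` (p35, next: the induction over `n + n′` and the derivative/value clauses of (1.16)).
USED BY NAME, never restated: p33's `B3Op116MajorantConvolution.{majorant_rate_mono, majorant_nonneg, sum_kernel_mul_le,
sum_bond_kernel_mul_le}`, r14's `B3Op116KernelRegularTorus.{majorant_shift_le, majorant_shift_le', sum_block_exp_le}`,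
`B3Op116ScaleChains.{sum_mesh_rpow_le, rate_eq}`, the typer's `HiggsAveraging.{blockK, blockIter}`.

## What is printed

[B3] p. 414 [PDF 4] (verbatim): *"for n, n′ sufficiently large, a kernel of the operator (1.16) is a sufficiently regular function of
both variables … uniformly bounded by O(1)(e(L^kε)^{1−α})^{n+n′} … This estimate follows easily from the properties of the propagators
G_k(Ω, A) proved in the next paper."*  [B3] p. 424 (2.6) `G_k(Ω,B̃) = Σ_j G^η_{(j)}(Ω,B̃)` and p. 426 (2.10) [PDF 16] (verbatim):
*"|G^η_{(j)}(Ω, B̃; x, x′)| ≤ O(1)(L^jη)^{−d+2}e^{−δ₁(L^jη)^{−1}|x−x′|}, (2.10) and if the propagator is differentiated, then for each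
differentiation, there is an additional factor (L^jη)^{−1} on the right side."*

## What this file proves, and how

§1 THE CURRENCY `𝔪_k(c,a;δ)(x,y) = Σ_{j<k} c(L^jε)^{a−d}e^{−δ(L^jε)^{−1}ε|x−y|}` (`maj`, r14/p33's summand shape verbatim) and its algebra:
symmetry, rate/constant monotonicity, additivity, a shift of either argument costs `e` (r14), **one power of the scale is worth `L^kε`**
(`maj_exponent_reduce`: `𝔪(c,a+1) ≤ 𝔪(c·L^kε,a)`), and **a top-scale bump is a range-`k` majorant at rate `δ/L`** (`top_le_maj`).
§2 **THE BLOCK AVERAGE OF A MAJORANT IS A TOP-SCALE BUMP** (`block_avg_maj_le`, exponent `a > 0`; r14's `sum_block_exp_le` scale by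
scale, `Σ_{j<k}(L^jε)^a ≤ (L^kε)^a/(L^a−1)`), hence again a majorant (`block_avg_maj_le_maj`) — what the averaging sources of `V_k` see.
§3 THE FIVE PAIRINGS of a row: derivative charges against the kernel at `b₊`/`b₋` (exponents add: `a_K + (a_v−1)`), value charges at
`b₋`/`b₊` (`a_K + a_v`), and the block-averaged value charges (`a_K + a_v`, rate `/4L`) — p33's `sum_bond_kernel_mul_le` /
`sum_kernel_mul_le`.  §4 **`row_step_le`**: the row `Σ_b[κ₁D(b)K(b₊) + (κ₂V(b₋) + κ₁D(b))K(b₋) + κ₃V(b₊)K(b₊)] + κ₄Σ_zK(z)·L^{−kd}Σ_{u∈B^k(z̄)}V(u)`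
(the shape of FILE 4α's `norm_covDeriv_G_srcV_le_leibniz` / `norm_G_srcV_apply_le_leibniz` with `κ₁ = |e|s`, `κ₂ = ε⁻¹|e|δ_A`, `κ₃ = (|e|s)²`,
`κ₄ = a_k(L^kε)^{−2}m(2+m)`) is `≤ 𝔪_k(stepC, a_K + a_v − 1; δ/(4L))(p, x′)` with the explicit constant `stepC` (the value charges and the
averaging term pay one `L^kε` to come down to the common exponent: `κ₂L^kε = L^k|e|δ_A`, `κ₃L^kε = |e|s·t`, `κ₄L^kε ≈ a·d|e|s`).
CONSEQUENCE (FILE 4β₂): with `a_K = 2` (value row) the value exponent grows by one per step, with `a_K = 1` (derivative row) the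
derivative exponent stays one below it — the induction over the `n + n′` factors `V_k` of (1.16).

## Honest scope

Real-number bookkeeping only: no field, propagator, or region enters (the kernels `K`, values `V`, derivatives `D` are abstract
nonnegative functions with majorants); `Ω = T_ε` (block sums over `B^k(z̄)`, `k ≤ K`; `L > 1`, `1 ≤ k`); rates halve/quarter per use and
are divided by `L` when a top bump re-enters the range-`k` family — constants only, uniform in `k` and in the volume.  Concrete `def`s
(`maj`, `convK`, `blkK`, `stepC`); no `def … : Prop`, no new named fact; axioms standard.  Value = located engine of a by-reference step
of B3, NOT summit progress.
-/

noncomputable section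

open scoped BigOperators

namespace Literature.MathematicalPhysics.QuantumFieldTheory.Balaban1983to89.B3Op116MajorantStep

open B1Eq230FluctCov (Ix)
open B1Ineq234Concrete (nCol)
open HiggsAveraging (blockK blockIter)
open B3Op116MajorantConvolution (majorant_rate_mono majorant_nonneg sum_kernel_mul_le sum_bond_kernel_mul_le)
open B3Op116KernelRegularTorus (majorant_shift_le majorant_shift_le' sum_block_exp_le)
open B3Op116ScaleChains (sum_mesh_rpow_le rate_eq)

variable {P : HiggsLattice.Params} {N : ℕ}

/-! ## §1 The majorant currency and its algebra -/

section Currency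

/-- **The (2.6)/(2.10) multi-scale majorant** `𝔪_k(c,a;δ)(x,y) = Σ_{j<k} c·(L^jε)^{a−d}·exp(−δ(L^jε)^{−1}ε|x−y|)` — exponent `a = 2` for
`G_k`, `1` per covariant derivative (r14's `col_le`/`dcol_le`, p33's `conv_majorant_le` summand shape verbatim). [cite: Balaban1983Higgs3, (2.6) p.424, (2.10) p.426] -/
def maj (P : HiggsLattice.Params) (k : ℕ) (c a δ : ℝ) (x y : HiggsLattice.Site P 0) : ℝ :=
  ∑ j ∈ Finset.range k, c * P.mesh j ^ (a - (P.d : ℝ)) *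
    Real.exp (-(δ * (P.mesh j)⁻¹ * (P.mesh 0 * (HiggsLattice.Site.tdist x y : ℝ))))

/-- `𝔪 ≥ 0` for `c ≥ 0`. [cite: Balaban1983Higgs3, (2.10) p.426] -/
theorem maj_nonneg {k : ℕ} {c a δ : ℝ} (hc : 0 ≤ c) (x y : HiggsLattice.Site P 0) : 0 ≤ maj P k c a δ x y :=
  majorant_nonneg hc x y

/-- `𝔪` is symmetric in its two sites (`|x − y| = |y − x|`). [cite: Balaban1983Higgs3, (2.10) p.426] -/
theorem maj_comm (k : ℕ) (c a δ : ℝ) (x y : HiggsLattice.Site P 0) : maj P k c a δ x y = maj P k c a δ y x := by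
  simp only [maj, B1Ineq234LevelZero.tdist_comm x y]

/-- A smaller rate gives a larger majorant (`c ≥ 0`). [cite: Balaban1983Higgs3, (2.10) p.426] -/
theorem maj_rate_mono {k : ℕ} {c a δ δ' : ℝ} (hc : 0 ≤ c) (hδ : δ' ≤ δ) (x y : HiggsLattice.Site P 0) :
    maj P k c a δ x y ≤ maj P k c a δ' x y :=
  majorant_rate_mono hc hδ x y

/-- A larger constant gives a larger majorant. [cite: Balaban1983Higgs3, (2.10) p.426] -/
theorem maj_const_mono {k : ℕ} {c c' a δ : ℝ} (hcc : c ≤ c') (x y : HiggsLattice.Site P 0) :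
    maj P k c a δ x y ≤ maj P k c' a δ x y :=
  Finset.sum_le_sum fun j _ => mul_le_mul_of_nonneg_right
    (mul_le_mul_of_nonneg_right hcc (Real.rpow_nonneg (P.mesh_pos j).le _)) (Real.exp_nonneg _)

/-- `𝔪` is additive in the constant. [cite: Balaban1983Higgs3, (2.10) p.426] -/
theorem maj_add (k : ℕ) (c c' a δ : ℝ) (x y : HiggsLattice.Site P 0) :
    maj P k c a δ x y + maj P k c' a δ x y = maj P k (c + c') a δ x y := by
  simp only [maj, ← Finset.sum_add_distrib]
  exact Finset.sum_congr rfl fun j _ => by ring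

/-- `𝔪` is homogeneous in the constant. [cite: Balaban1983Higgs3, (2.10) p.426] -/
theorem mul_maj (k : ℕ) (r c a δ : ℝ) (x y : HiggsLattice.Site P 0) :
    r * maj P k c a δ x y = maj P k (r * c) a δ x y := by
  simp only [maj, Finset.mul_sum]
  exact Finset.sum_congr rfl fun j _ => by ring

/-- A majorant read one lattice step away in the second site costs a factor `e` (r14's `majorant_shift_le`; `0 < δ ≤ 1`, `c ≥ 0`).
[cite: Balaban1983Higgs3, (2.10) p.426] -/
theorem maj_shift_right {k : ℕ} {c a δ : ℝ} (hδ : 0 < δ) (hδ1 : δ ≤ 1) (hc : 0 ≤ c) (x y : HiggsLattice.Site P 0) (μ : Fin P.d) :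
    maj P k c a δ x (y.shift μ) ≤ maj P k (Real.exp 1 * c) a δ x y :=
  majorant_shift_le hδ hδ1 hc x y μ

/-- The same in the first site (r14's `majorant_shift_le'`). [cite: Balaban1983Higgs3, (2.10) p.426] -/
theorem maj_shift_left {k : ℕ} {c a δ : ℝ} (hδ : 0 < δ) (hδ1 : δ ≤ 1) (hc : 0 ≤ c) (x y : HiggsLattice.Site P 0) (μ : Fin P.d) :
    maj P k c a δ (x.shift μ) y ≤ maj P k (Real.exp 1 * c) a δ x y :=
  majorant_shift_le' hδ hδ1 hc x y μ

/-- **One power of the scale is worth `L^kε`**: `𝔪_k(c, a; δ) ≤ 𝔪_k(c·L^kε, a − 1; δ)` (`(L^jε)^{a−d} = (L^jε)^{a−1−d}·L^jε ≤ (L^jε)^{a−1−d}·L^kε`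
for `j < k`; `c ≥ 0`). [cite: Balaban1983Higgs3, (2.6) p.424, (2.10) p.426] -/
theorem maj_exponent_reduce {k : ℕ} {c a δ : ℝ} (hc : 0 ≤ c) (x y : HiggsLattice.Site P 0) :
    maj P k c a δ x y ≤ maj P k (c * P.mesh k) (a - 1) δ x y := by
  unfold maj
  refine Finset.sum_le_sum fun j hj => ?_
  have hjk : j ≤ k := (Finset.mem_range.1 hj).le
  have hmj : 0 < P.mesh j := P.mesh_pos j
  -- `L^jε ≤ L^kε` (the tree's `B2Prop31ZeroFieldConcrete.mesh_le_mesh`, inlined to keep the imports light)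
  have hmesh : P.mesh j ≤ P.mesh k := by
    unfold HiggsLattice.Params.mesh
    have hL1 : (1 : ℝ) ≤ (P.L : ℝ) := by exact_mod_cast P.hL
    exact mul_le_mul_of_nonneg_right (pow_le_pow_right₀ hL1 hjk) P.hε.le
  have hsplit : P.mesh j ^ (a - (P.d : ℝ)) = P.mesh j ^ (a - 1 - (P.d : ℝ)) * P.mesh j := by
    rw [show a - (P.d : ℝ) = (a - 1 - (P.d : ℝ)) + 1 by ring, Real.rpow_add hmj, Real.rpow_one]
  rw [hsplit]
  have h1 : c * (P.mesh j ^ (a - 1 - (P.d : ℝ)) * P.mesh j) ≤ c * P.mesh k * P.mesh j ^ (a - 1 - (P.d : ℝ)) := by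
    rw [show c * P.mesh k * P.mesh j ^ (a - 1 - (P.d : ℝ)) = c * (P.mesh j ^ (a - 1 - (P.d : ℝ)) * P.mesh k) by ring]
    exact mul_le_mul_of_nonneg_left (mul_le_mul_of_nonneg_left hmesh (Real.rpow_nonneg hmj.le _)) hc
  exact mul_le_mul_of_nonneg_right h1 (Real.exp_nonneg _)

/-- **A top-scale bump is a range-`k` majorant at the rate `δ/L`** (`k ≥ 1`): `c(L^kε)^{a−d}e^{−δ(L^kε)^{−1}ε|x−y|} =
(cL^{a−d})(L^{k−1}ε)^{a−d}e^{−(δ/L)(L^{k−1}ε)^{−1}ε|x−y|}`, the summand `j = k − 1`. [cite: Balaban1983Higgs3, (2.6) p.424, (2.10) p.426] -/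
theorem top_le_maj {k : ℕ} (hk : 1 ≤ k) {c a δ : ℝ} (hc : 0 ≤ c) (x y : HiggsLattice.Site P 0) :
    c * P.mesh k ^ (a - (P.d : ℝ)) * Real.exp (-(δ * (P.mesh k)⁻¹ * (P.mesh 0 * (HiggsLattice.Site.tdist x y : ℝ))))
      ≤ maj P k (c * (P.L : ℝ) ^ (a - (P.d : ℝ))) a (δ / P.L) x y := by
  obtain ⟨k', rfl⟩ : ∃ k', k = k' + 1 := ⟨k - 1, by omega⟩
  have hL0 : (0 : ℝ) < (P.L : ℝ) := by have := P.hL; positivity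
  have hmk : 0 < P.mesh k' := P.mesh_pos k'
  have hterm : ∀ j ∈ Finset.range (k' + 1), 0 ≤ c * (P.L : ℝ) ^ (a - (P.d : ℝ)) * P.mesh j ^ (a - (P.d : ℝ)) *
      Real.exp (-(δ / P.L * (P.mesh j)⁻¹ * (P.mesh 0 * (HiggsLattice.Site.tdist x y : ℝ)))) :=
    fun j _ => mul_nonneg (mul_nonneg (mul_nonneg hc (Real.rpow_nonneg hL0.le _)) (Real.rpow_nonneg (P.mesh_pos j).le _))
      (Real.exp_nonneg _)
  refine le_trans (le_of_eq ?_) (Finset.single_le_sum hterm (Finset.self_mem_range_succ k'))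
  -- `L^{k'+1}ε = L·L^{k'}ε` (the tree's `B2Ineq2116Region.mesh_succ`, inlined to keep the imports light)
  have hsucc : P.mesh (k' + 1) = (P.L : ℝ) * P.mesh k' := by
    unfold HiggsLattice.Params.mesh
    ring
  rw [hsucc, Real.mul_rpow hL0.le hmk.le]
  have hexp : δ * ((P.L : ℝ) * P.mesh k')⁻¹ = δ / P.L * (P.mesh k')⁻¹ := by
    rw [mul_inv, div_eq_mul_inv, mul_assoc]
  rw [hexp]
  ring

/-- p33's convolution constant `K(a₁,a₂;δ) = N(8d/δ)^d(ε^d)^{−1}(L^{a₁}/(L^{a₁}−1) + L^{a₂}/(L^{a₂}−1))` (`conv_majorant_le`).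
[cite: Balaban1983Higgs3, (2.6) p.424, (2.10) p.426] -/
def convK (P : HiggsLattice.Params) (N : ℕ) (δ a₁ a₂ : ℝ) : ℝ :=
  (nCol N : ℝ) * (8 * P.d / δ) ^ P.d * (P.mesh 0 ^ P.d)⁻¹ *
    ((P.L : ℝ) ^ a₁ / ((P.L : ℝ) ^ a₁ - 1) + (P.L : ℝ) ^ a₂ / ((P.L : ℝ) ^ a₂ - 1))

/-- `K(a₁,a₂;δ) ≥ 0` for `a₁, a₂ > 0`, `δ > 0`, `L > 1`. [cite: Balaban1983Higgs3, (2.10) p.426] -/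
theorem convK_nonneg (hL : 1 < P.L) {δ a₁ a₂ : ℝ} (hδ : 0 < δ) (ha₁ : 0 < a₁) (ha₂ : 0 < a₂) : 0 ≤ convK P N δ a₁ a₂ := by
  have hL1 : (1 : ℝ) < (P.L : ℝ) := by exact_mod_cast hL
  have h1 : 0 < (P.L : ℝ) ^ a₁ - 1 := by have := Real.one_lt_rpow hL1 ha₁; linarith
  have h2 : 0 < (P.L : ℝ) ^ a₂ - 1 := by have := Real.one_lt_rpow hL1 ha₂; linarith
  have h3 : 0 ≤ (P.L : ℝ) ^ a₁ := Real.rpow_nonneg (by positivity) _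
  have h4 : 0 ≤ (P.L : ℝ) ^ a₂ := Real.rpow_nonneg (by positivity) _
  have := P.mesh_pos 0
  unfold convK
  positivity

end Currency

/-! ## §2 The block average of a majorant is a top-scale bump -/

section Blocks

/-- scale algebra of a block average, general exponent: `(L^jε)^{a−d}(L^j)^d(L^{kd})^{−1} = (L^jε)^a((L^kε)^d)^{−1}`.
[cite: Balaban1983Higgs3, (2.10) p.426] -/
theorem blockavg_scale_algebra' (j k : ℕ) (a : ℝ) :
    P.mesh j ^ (a - (P.d : ℝ)) * ((P.L : ℝ) ^ j) ^ P.d * (((P.L : ℝ) ^ (k * P.d))⁻¹)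
      = P.mesh j ^ a * (P.mesh k ^ P.d)⁻¹ := by
  have hL0 : (0 : ℝ) < (P.L : ℝ) := by have := P.hL; positivity
  have hmj : 0 < P.mesh j := P.mesh_pos j
  have hε : 0 < P.ε := P.hε
  rw [Real.rpow_sub hmj, Real.rpow_natCast]
  unfold HiggsLattice.Params.mesh
  rw [mul_pow, mul_pow, pow_mul]
  have h1 : ((P.L : ℝ) ^ j) ^ P.d ≠ 0 := by positivity
  have h2 : ((P.L : ℝ) ^ k) ^ P.d ≠ 0 := by positivity
  have h3 : P.ε ^ P.d ≠ 0 := by positivity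
  field_simp

/-- the block constant `[e^{δ/2}N(8d/δ)^d/(L^a−1)]`. [cite: Balaban1983Higgs3, (2.10) p.426] -/
def blkK (P : HiggsLattice.Params) (N : ℕ) (δ a : ℝ) : ℝ :=
  Real.exp (δ / 2) * ((nCol N : ℝ) * (4 * P.d / (δ / 2)) ^ P.d) / ((P.L : ℝ) ^ a - 1)

/-- `blkK ≥ 0` (`a > 0`, `δ > 0`, `L > 1`). [cite: Balaban1983Higgs3, (2.10) p.426] -/
theorem blkK_nonneg (hL : 1 < P.L) {δ a : ℝ} (hδ : 0 < δ) (ha : 0 < a) : 0 ≤ blkK P N δ a := by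
  have hL1 : (1 : ℝ) < (P.L : ℝ) := by exact_mod_cast hL
  have h1 : 0 < (P.L : ℝ) ^ a - 1 := by have := Real.one_lt_rpow hL1 ha; linarith
  have h2 : 0 ≤ (4 * (P.d : ℝ) / (δ / 2)) ^ P.d := pow_nonneg (by positivity) _
  unfold blkK
  positivity

/-- **THE BLOCK AVERAGE OF A MAJORANT IS A SINGLE TOP-SCALE BUMP** (`a > 0`, `1 ≤ k ≤ K`, `0 < δ ≤ 1`, `c ≥ 0`):
`L^{−kd}Σ_{u∈B^k(z̄)} 𝔪_k(c,a;δ)(u,x′) ≤ blkK·c·(L^kε)^{a−d}·e^{−(δ/2)(L^kε)^{−1}ε|z−x′|}` — r14's `sum_block_exp_le` scale by scale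
(half the decay kept at the block scale, volume `N(8d/δ)^dL^{jd}`), then `Σ_{j<k}(L^jε)^a ≤ (L^kε)^a/(L^a−1)`; the averaging operators
`Q_k`, `F_{2,k}` of the sources of `V_k` read their argument through such block averages. [cite: Balaban1982Higgs1, (1.20) p.607, (3.15) p.614] [cite: Balaban1983Higgs3, (2.10) p.426] -/
theorem block_avg_maj_le (hL : 1 < P.L) {k : ℕ} (hkK : k ≤ P.K) {δ : ℝ} (hδ : 0 < δ) (hδ1 : δ ≤ 1) {c a : ℝ}
    (hc : 0 ≤ c) (ha : 0 < a) (i₀ : Ix N) (z x' : HiggsLattice.Site P 0) :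
    ((P.L : ℝ) ^ (k * P.d))⁻¹ * ∑ u ∈ blockK k (blockIter k z), maj P k c a δ u x'
      ≤ blkK P N δ a * c * P.mesh k ^ (a - (P.d : ℝ)) *
          Real.exp (-(δ / 2 * (P.mesh k)⁻¹ * (P.mesh 0 * (HiggsLattice.Site.tdist z x' : ℝ)))) := by
  have hL1' : (1 : ℝ) < (P.L : ℝ) := by exact_mod_cast hL
  have hLk0 : (0 : ℝ) < ((P.L : ℝ) ^ (k * P.d))⁻¹ := by positivity
  set E : ℝ := Real.exp (-(δ / 2 * (P.mesh k)⁻¹ * (P.mesh 0 * (HiggsLattice.Site.tdist z x' : ℝ)))) with hE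
  set Kb : ℝ := Real.exp (δ / 2) * ((nCol N : ℝ) * (4 * P.d / (δ / 2)) ^ P.d) with hKb
  have hKb0 : 0 ≤ Kb := by
    have : 0 ≤ (4 * (P.d : ℝ) / (δ / 2)) ^ P.d := pow_nonneg (by positivity) _
    rw [hKb]; positivity
  -- step 1: exchange the sums
  have step1 : ∑ u ∈ blockK k (blockIter k z), maj P k c a δ u x'
      = ∑ j ∈ Finset.range k, c * P.mesh j ^ (a - (P.d : ℝ)) *
          ∑ u ∈ blockK k (blockIter k z), Real.exp (-(δ / (P.L : ℝ) ^ j * (HiggsLattice.Site.tdist u x' : ℝ))) := by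
    unfold maj
    rw [Finset.sum_comm]
    refine Finset.sum_congr rfl fun j _ => ?_
    rw [Finset.mul_sum]
    exact Finset.sum_congr rfl fun u _ => by rw [rate_eq]
  -- step 2: each block sum
  have step2 : ∀ j ∈ Finset.range k,
      c * P.mesh j ^ (a - (P.d : ℝ)) *
          ∑ u ∈ blockK k (blockIter k z), Real.exp (-(δ / (P.L : ℝ) ^ j * (HiggsLattice.Site.tdist u x' : ℝ)))
        ≤ c * Kb * E * (P.mesh j ^ (a - (P.d : ℝ)) * ((P.L : ℝ) ^ j) ^ P.d) := by
    intro j hj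
    have hjk : j ≤ k := (Finset.mem_range.1 hj).le
    have hb := sum_block_exp_le (N := N) hkK hδ hδ1 hjk z x' i₀
    have hE' : Real.exp (-(δ / 2 / (P.L : ℝ) ^ k * (HiggsLattice.Site.tdist z x' : ℝ))) = E := by
      rw [hE, ← rate_eq]
    rw [hE'] at hb
    have hℓ : 0 ≤ c * P.mesh j ^ (a - (P.d : ℝ)) := mul_nonneg hc (Real.rpow_nonneg (P.mesh_pos j).le _)
    refine (mul_le_mul_of_nonneg_left hb hℓ).trans (le_of_eq ?_)
    rw [hKb]; ring
  -- step 3: the scale sum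
  have step3 : ∑ j ∈ Finset.range k, P.mesh j ^ (a - (P.d : ℝ)) * ((P.L : ℝ) ^ j) ^ P.d * ((P.L : ℝ) ^ (k * P.d))⁻¹
      ≤ P.mesh k ^ a / ((P.L : ℝ) ^ a - 1) * (P.mesh k ^ P.d)⁻¹ := by
    simp_rw [blockavg_scale_algebra']
    rw [← Finset.sum_mul]
    exact mul_le_mul_of_nonneg_right (sum_mesh_rpow_le ha hL k) (inv_nonneg.mpr (pow_nonneg (P.mesh_pos k).le _))
  have hpow : P.mesh k ^ a * (P.mesh k ^ P.d)⁻¹ = P.mesh k ^ (a - (P.d : ℝ)) := by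
    rw [Real.rpow_sub (P.mesh_pos k), Real.rpow_natCast, div_eq_mul_inv]
  -- assemble
  calc ((P.L : ℝ) ^ (k * P.d))⁻¹ * ∑ u ∈ blockK k (blockIter k z), maj P k c a δ u x'
      ≤ ((P.L : ℝ) ^ (k * P.d))⁻¹ * ∑ j ∈ Finset.range k, c * Kb * E * (P.mesh j ^ (a - (P.d : ℝ)) * ((P.L : ℝ) ^ j) ^ P.d) := by
        rw [step1]; exact mul_le_mul_of_nonneg_left (Finset.sum_le_sum step2) hLk0.le
    _ = c * Kb * E * ∑ j ∈ Finset.range k, P.mesh j ^ (a - (P.d : ℝ)) * ((P.L : ℝ) ^ j) ^ P.d * ((P.L : ℝ) ^ (k * P.d))⁻¹ := by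
        rw [Finset.mul_sum, Finset.mul_sum]
        exact Finset.sum_congr rfl fun j _ => by ring
    _ ≤ c * Kb * E * (P.mesh k ^ a / ((P.L : ℝ) ^ a - 1) * (P.mesh k ^ P.d)⁻¹) :=
        mul_le_mul_of_nonneg_left step3 (by positivity)
    _ = blkK P N δ a * c * P.mesh k ^ (a - (P.d : ℝ)) * E := by
        rw [← hpow, blkK, ← hKb]; ring
    _ = _ := by rw [hE]

/-- **The block average of a majorant is again a majorant** (range `k`, rate `δ/(2L)`, constant `blkK·c·L^{a−d}`; `k ≥ 1`).
[cite: Balaban1983Higgs3, (2.6) p.424, (2.10) p.426] -/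
theorem block_avg_maj_le_maj (hL : 1 < P.L) {k : ℕ} (hk : 1 ≤ k) (hkK : k ≤ P.K) {δ : ℝ} (hδ : 0 < δ) (hδ1 : δ ≤ 1)
    {c a : ℝ} (hc : 0 ≤ c) (ha : 0 < a) (i₀ : Ix N) (z x' : HiggsLattice.Site P 0) :
    ((P.L : ℝ) ^ (k * P.d))⁻¹ * ∑ u ∈ blockK k (blockIter k z), maj P k c a δ u x'
      ≤ maj P k (blkK P N δ a * c * (P.L : ℝ) ^ (a - (P.d : ℝ))) a (δ / 2 / P.L) z x' := by
  refine (block_avg_maj_le hL hkK hδ hδ1 hc ha i₀ z x').trans ?_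
  exact top_le_maj hk (mul_nonneg (blkK_nonneg hL hδ ha) hc) z x'

end Blocks

/-! ## §3 The five pairings of a row of `G_kV_kw` against a majorised kernel -/

section Pairings

variable (hL : 1 < P.L) {k : ℕ} (hk : 1 ≤ k) (hkK : k ≤ P.K) {δ : ℝ} (hδ : 0 < δ) (hδ1 : δ ≤ 1)
  {aK av cK cv cd : ℝ} (haK : 0 < aK) (hav : 1 < av) (hcK : 0 ≤ cK) (hcv : 0 ≤ cv) (hcd : 0 ≤ cd)
  (i₀ : Ix N) (p x' : HiggsLattice.Site P 0)
  (K : HiggsLattice.Site P 0 → ℝ) (hK0 : ∀ y, 0 ≤ K y) (hK : ∀ y, K y ≤ maj P k cK aK δ p y)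
  (Vf : HiggsLattice.Site P 0 → ℝ) (hV0 : ∀ y, 0 ≤ Vf y) (hV : ∀ y, Vf y ≤ maj P k cv av δ y x')
  (Df : HiggsLattice.PBond P 0 → ℝ) (hD0 : ∀ b, 0 ≤ Df b) (hD : ∀ b, Df b ≤ maj P k cd (av - 1) δ b.src x')
include hL hδ hδ1 haK i₀

section DPair
include hcK hcd hK0 hK hD0 hD hav

/-- (i) derivative charges against the kernel read at the bond HEAD: `Σ_b D(b)K(b₊) ≤ d·𝔪_k(e·c_K·c_d·K, a_K + (a_v−1); δ/2)(p,x′)`.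
[cite: Balaban1983Higgs3, (1.16) p.414, (2.10) p.426] -/
theorem pair_D_tgt_le :
    ∑ b : HiggsLattice.PBond P 0, Df b * K b.tgt
      ≤ (P.d : ℝ) * maj P k (Real.exp 1 * cK * cd * convK P N δ aK (av - 1)) (aK + (av - 1)) (δ / 2) p x' := by
  have hav1 : 0 < av - 1 := by linarith
  have h := sum_bond_kernel_mul_le hL hδ hδ1 haK hav1 (mul_nonneg (Real.exp_nonneg _) hcK) hcd i₀ p x'
    (fun b => K b.tgt) Df (fun b => hK0 _) hD0 (fun b => (hK b.tgt).trans (maj_shift_right hδ hδ1 hcK p b.src b.dir)) hD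
  simp only [mul_comm (Df _) (K _)]
  refine h.trans (le_of_eq ?_)
  unfold maj convK
  rfl

/-- (iii) derivative charges against the kernel read at the bond BASE: `Σ_b D(b)K(b₋) ≤ d·𝔪_k(c_K·c_d·K, a_K + (a_v−1); δ/2)(p,x′)`.
[cite: Balaban1983Higgs3, (1.16) p.414, (2.10) p.426] -/
theorem pair_D_src_le :
    ∑ b : HiggsLattice.PBond P 0, Df b * K b.src
      ≤ (P.d : ℝ) * maj P k (cK * cd * convK P N δ aK (av - 1)) (aK + (av - 1)) (δ / 2) p x' := by
  have hav1 : 0 < av - 1 := by linarith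
  have h := sum_bond_kernel_mul_le hL hδ hδ1 haK hav1 hcK hcd i₀ p x'
    (fun b => K b.src) Df (fun b => hK0 _) hD0 (fun b => hK b.src) hD
  simp only [mul_comm (Df _) (K _)]
  refine h.trans (le_of_eq ?_)
  unfold maj convK
  rfl

end DPair

section VPair
include hcK hcv hK0 hK hV0 hV hav

/-- (ii) value charges against the kernel, both read at the bond BASE: `Σ_b V(b₋)K(b₋) ≤ d·𝔪_k(c_K·c_v·K, a_K + a_v; δ/2)(p,x′)`.
[cite: Balaban1983Higgs3, (1.16) p.414, (2.10) p.426] -/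
theorem pair_V_src_le :
    ∑ b : HiggsLattice.PBond P 0, Vf b.src * K b.src
      ≤ (P.d : ℝ) * maj P k (cK * cv * convK P N δ aK av) (aK + av) (δ / 2) p x' := by
  have hav0 : 0 < av := by linarith
  have h := sum_bond_kernel_mul_le hL hδ hδ1 haK hav0 hcK hcv i₀ p x'
    (fun b => K b.src) (fun b => Vf b.src) (fun b => hK0 _) (fun b => hV0 _) (fun b => hK b.src) (fun b => hV b.src)
  simp only [mul_comm (Vf _) (K _)]
  refine h.trans (le_of_eq ?_)
  unfold maj convK
  rfl

/-- (iv) value charges against the kernel, both read at the bond HEAD: `Σ_b V(b₊)K(b₊) ≤ d·𝔪_k(e²·c_K·c_v·K, a_K + a_v; δ/2)(p,x′)`.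
[cite: Balaban1983Higgs3, (1.16) p.414, (2.10) p.426] -/
theorem pair_V_tgt_le :
    ∑ b : HiggsLattice.PBond P 0, Vf b.tgt * K b.tgt
      ≤ (P.d : ℝ) * maj P k (Real.exp 1 * cK * (Real.exp 1 * cv) * convK P N δ aK av) (aK + av) (δ / 2) p x' := by
  have hav0 : 0 < av := by linarith
  have h := sum_bond_kernel_mul_le hL hδ hδ1 haK hav0 (mul_nonneg (Real.exp_nonneg _) hcK)
    (mul_nonneg (Real.exp_nonneg _) hcv) i₀ p x'
    (fun b => K b.tgt) (fun b => Vf b.tgt) (fun b => hK0 _) (fun b => hV0 _)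
    (fun b => (hK b.tgt).trans (maj_shift_right hδ hδ1 hcK p b.src b.dir))
    (fun b => (hV b.tgt).trans (maj_shift_left hδ hδ1 hcv b.src x' b.dir))
  simp only [mul_comm (Vf _) (K _)]
  refine h.trans (le_of_eq ?_)
  unfold maj convK
  rfl

include hk hkK in
/-- (v) the block-averaged value charges against the kernel: `Σ_zK(z)·L^{−kd}Σ_{u∈B^k(z̄)}V(u) ≤ 𝔪_k(…, a_K + a_v; δ/(4L))(p,x′)`
(§2 + p33's `sum_kernel_mul_le` at the rate `δ/(2L)`). [cite: Balaban1982Higgs1, (3.15)–(3.16) pp.614–615] [cite: Balaban1983Higgs3, (1.16) p.414, (2.10) p.426] -/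
theorem pair_avg_le :
    ∑ z : HiggsLattice.Site P 0, K z * (((P.L : ℝ) ^ (k * P.d))⁻¹ * ∑ u ∈ blockK k (blockIter k z), Vf u)
      ≤ maj P k (cK * (blkK P N δ av * cv * (P.L : ℝ) ^ (av - (P.d : ℝ))) * convK P N (δ / 2 / P.L) aK av)
          (aK + av) (δ / 2 / P.L / 2) p x' := by
  have hav0 : 0 < av := by linarith
  have hL1 : (1 : ℝ) < (P.L : ℝ) := by exact_mod_cast hL
  have hL0 : (0 : ℝ) < (P.L : ℝ) := by linarith
  have hδ' : 0 < δ / 2 / P.L := by positivity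
  have hδ'δ : δ / 2 / P.L ≤ δ := by
    rw [div_div, div_le_iff₀ (by positivity)]; nlinarith
  have hδ'1 : δ / 2 / P.L ≤ 1 := hδ'δ.trans hδ1
  have hcb : 0 ≤ blkK P N δ av * cv * (P.L : ℝ) ^ (av - (P.d : ℝ)) :=
    mul_nonneg (mul_nonneg (blkK_nonneg hL hδ hav0) hcv) (Real.rpow_nonneg hL0.le _)
  have hblk0 : ∀ z, 0 ≤ ((P.L : ℝ) ^ (k * P.d))⁻¹ * ∑ u ∈ blockK k (blockIter k z), Vf u :=
    fun z => mul_nonneg (inv_nonneg.mpr (pow_nonneg hL0.le _)) (Finset.sum_nonneg fun u _ => hV0 u)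
  have hblk : ∀ z, ((P.L : ℝ) ^ (k * P.d))⁻¹ * ∑ u ∈ blockK k (blockIter k z), Vf u
      ≤ maj P k (blkK P N δ av * cv * (P.L : ℝ) ^ (av - (P.d : ℝ))) av (δ / 2 / P.L) z x' := by
    intro z
    refine le_trans (mul_le_mul_of_nonneg_left (Finset.sum_le_sum fun u _ => hV u) (inv_nonneg.mpr (pow_nonneg hL0.le _))) ?_
    exact block_avg_maj_le_maj hL hk hkK hδ hδ1 hcv hav0 i₀ z x'
  have hK' : ∀ z, K z ≤ maj P k cK aK (δ / 2 / P.L) p z := fun z => (hK z).trans (maj_rate_mono hcK hδ'δ p z)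
  exact sum_kernel_mul_le hL hδ' hδ'1 haK hav0 hcK hcb i₀ p x' K _ hK0 hblk0 hK' hblk

end VPair

end Pairings

/-! ## §4 The step: a whole row of `G_kV_kw` is a majorant with exponent `a_K + a_v − 1` -/

section Step

/-- the constant of one step (explicit; every factor displayed). [cite: Balaban1983Higgs3, (1.16) p.414, (2.10) p.426] -/
def stepC (P : HiggsLattice.Params) (N : ℕ) (k : ℕ) (δ aK av cK cv cd κ₁ κ₂ κ₃ κ₄ : ℝ) : ℝ :=
  (P.d : ℝ) * (κ₁ * (Real.exp 1 * cK * cd * convK P N δ aK (av - 1)) + κ₁ * (cK * cd * convK P N δ aK (av - 1)))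
    + P.mesh k * ((P.d : ℝ) * (κ₂ * (cK * cv * convK P N δ aK av)
        + κ₃ * (Real.exp 1 * cK * (Real.exp 1 * cv) * convK P N δ aK av))
      + κ₄ * (cK * (blkK P N δ av * cv * (P.L : ℝ) ^ (av - (P.d : ℝ))) * convK P N (δ / 2 / P.L) aK av))

/-- `stepC ≥ 0` (all its factors are nonnegative: `a_K > 0`, `a_v > 1`, `δ > 0`, `L > 1`). [cite: Balaban1983Higgs3, (2.10) p.426] -/
theorem stepC_nonneg (hL : 1 < P.L) (k : ℕ) {δ aK av cK cv cd κ₁ κ₂ κ₃ κ₄ : ℝ} (hδ : 0 < δ) (haK : 0 < aK) (hav : 1 < av)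
    (hcK : 0 ≤ cK) (hcv : 0 ≤ cv) (hcd : 0 ≤ cd) (hκ₁ : 0 ≤ κ₁) (hκ₂ : 0 ≤ κ₂) (hκ₃ : 0 ≤ κ₃) (hκ₄ : 0 ≤ κ₄) :
    0 ≤ stepC P N k δ aK av cK cv cd κ₁ κ₂ κ₃ κ₄ := by
  have hL1 : (1 : ℝ) < (P.L : ℝ) := by exact_mod_cast hL
  have hL0 : (0 : ℝ) < (P.L : ℝ) := by linarith
  have hav0 : 0 < av := by linarith
  have hav1 : 0 < av - 1 := by linarith
  have hK1 : 0 ≤ convK P N δ aK (av - 1) := convK_nonneg hL hδ haK hav1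
  have hK2 : 0 ≤ convK P N δ aK av := convK_nonneg hL hδ haK hav0
  have hK3 : 0 ≤ convK P N (δ / 2 / P.L) aK av := convK_nonneg hL (by positivity) haK hav0
  have hb : 0 ≤ blkK P N δ av := blkK_nonneg hL hδ hav0
  have hLp : 0 ≤ (P.L : ℝ) ^ (av - (P.d : ℝ)) := Real.rpow_nonneg hL0.le _
  have hm : 0 ≤ P.mesh k := (P.mesh_pos k).le
  have he : 0 ≤ Real.exp 1 := Real.exp_nonneg _
  unfold stepC
  positivity

/-- **ONE STEP `w ↦ G_k(T_ε,X)V_k(A,B)w` IN THE MAJORANT CURRENCY.**  If the kernel `K ≥ 0` of the row is majorised with exponent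
`a_K > 0` from the evaluation point `p`, the values `V ≥ 0` of `w` with exponent `a_v > 1` and its derivatives `D ≥ 0` (read at `b₋`)
with exponent `a_v − 1`, all at the rate `0 < δ ≤ 1` over the scales `j < k` (`1 ≤ k ≤ K`), then for all `κ₁, κ₂, κ₃, κ₄ ≥ 0` the row
`Σ_b[κ₁D(b)K(b₊) + (κ₂V(b₋) + κ₁D(b))K(b₋) + κ₃V(b₊)K(b₊)] + κ₄·Σ_zK(z)L^{−kd}Σ_{u∈B^k(z̄)}V(u) ≤ 𝔪_k(stepC, a_K + a_v − 1; δ/(4L))(p, x′)`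
— the shape of FILE 4α's Leibniz rows (`κ₁ = |e|s`, `κ₂ = ε⁻¹|e|δ_A`, `κ₃ = (|e|s)²`, `κ₄ = a_k(L^kε)^{−2}m(2+m)`, `K = κ_X(x,·)` or
`κ^D_{B,X}(b₀,·)`); the value and averaging pairings pay one `L^kε` (`maj_exponent_reduce`) to meet the derivative pairings' exponent.
[cite: Balaban1983Higgs3, (1.16) p.414, (2.6) p.424, (2.10) p.426] [cite: Balaban1982Higgs1, (3.16) p.615] -/
theorem row_step_le (hL : 1 < P.L) {k : ℕ} (hk : 1 ≤ k) (hkK : k ≤ P.K) {δ : ℝ} (hδ : 0 < δ) (hδ1 : δ ≤ 1)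
    {aK av cK cv cd κ₁ κ₂ κ₃ κ₄ : ℝ} (haK : 0 < aK) (hav : 1 < av) (hcK : 0 ≤ cK) (hcv : 0 ≤ cv) (hcd : 0 ≤ cd)
    (hκ₁ : 0 ≤ κ₁) (hκ₂ : 0 ≤ κ₂) (hκ₃ : 0 ≤ κ₃) (hκ₄ : 0 ≤ κ₄)
    (i₀ : Ix N) (p x' : HiggsLattice.Site P 0)
    (K : HiggsLattice.Site P 0 → ℝ) (hK0 : ∀ y, 0 ≤ K y) (hK : ∀ y, K y ≤ maj P k cK aK δ p y)
    (Vf : HiggsLattice.Site P 0 → ℝ) (hV0 : ∀ y, 0 ≤ Vf y) (hV : ∀ y, Vf y ≤ maj P k cv av δ y x')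
    (Df : HiggsLattice.PBond P 0 → ℝ) (hD0 : ∀ b, 0 ≤ Df b) (hD : ∀ b, Df b ≤ maj P k cd (av - 1) δ b.src x') :
    (∑ b : HiggsLattice.PBond P 0,
        (κ₁ * Df b * K b.tgt + (κ₂ * Vf b.src + κ₁ * Df b) * K b.src + κ₃ * Vf b.tgt * K b.tgt))
      + κ₄ * ∑ z : HiggsLattice.Site P 0, K z * (((P.L : ℝ) ^ (k * P.d))⁻¹ * ∑ u ∈ blockK k (blockIter k z), Vf u)
      ≤ maj P k (stepC P N k δ aK av cK cv cd κ₁ κ₂ κ₃ κ₄) (aK + av - 1) (δ / 2 / P.L / 2) p x' := by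
  have hL1 : (1 : ℝ) < (P.L : ℝ) := by exact_mod_cast hL
  have hL0 : (0 : ℝ) < (P.L : ℝ) := by linarith
  have hav0 : 0 < av := by linarith
  have hav1 : 0 < av - 1 := by linarith
  -- the final rate is below δ/2
  have hrate : δ / 2 / P.L / 2 ≤ δ / 2 := by
    rw [div_div, div_le_iff₀ (by positivity)]; nlinarith
  -- nonnegativity of the pairing constants
  have hK1 : 0 ≤ convK P N δ aK (av - 1) := convK_nonneg hL hδ haK hav1
  have hK2 : 0 ≤ convK P N δ aK av := convK_nonneg hL hδ haK hav0
  have hK3 : 0 ≤ convK P N (δ / 2 / P.L) aK av := convK_nonneg hL (by positivity) haK hav0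
  have hcb : 0 ≤ blkK P N δ av * cv * (P.L : ℝ) ^ (av - (P.d : ℝ)) :=
    mul_nonneg (mul_nonneg (blkK_nonneg hL hδ hav0) hcv) (Real.rpow_nonneg hL0.le _)
  have e1 : 0 ≤ Real.exp 1 := Real.exp_nonneg _
  -- the five pairings
  have h1 := pair_D_tgt_le hL hδ hδ1 haK hav hcK hcd i₀ p x' K hK0 hK Df hD0 hD
  have h3 := pair_D_src_le hL hδ hδ1 haK hav hcK hcd i₀ p x' K hK0 hK Df hD0 hD
  have h2 := pair_V_src_le hL hδ hδ1 haK hav hcK hcv i₀ p x' K hK0 hK Vf hV0 hV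
  have h4 := pair_V_tgt_le hL hδ hδ1 haK hav hcK hcv i₀ p x' K hK0 hK Vf hV0 hV
  have h5 := pair_avg_le hL hk hkK hδ hδ1 haK hav hcK hcv i₀ p x' K hK0 hK Vf hV0 hV
  -- bring every pairing to the exponent aK + av − 1 and the rate δ/2/L/2
  have hA : ∀ {c : ℝ}, 0 ≤ c → maj P k c (aK + (av - 1)) (δ / 2) p x' ≤ maj P k c (aK + av - 1) (δ / 2 / P.L / 2) p x' := by
    intro c hc
    rw [show aK + (av - 1) = aK + av - 1 by ring]
    exact maj_rate_mono hc hrate p x'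
  have hB : ∀ {c : ℝ}, 0 ≤ c → maj P k c (aK + av) (δ / 2) p x' ≤ maj P k (c * P.mesh k) (aK + av - 1) (δ / 2 / P.L / 2) p x' := by
    intro c hc
    exact (maj_exponent_reduce hc p x').trans (maj_rate_mono (mul_nonneg hc (P.mesh_pos k).le) hrate p x')
  have hB' : ∀ {c : ℝ}, 0 ≤ c → maj P k c (aK + av) (δ / 2 / P.L / 2) p x' ≤ maj P k (c * P.mesh k) (aK + av - 1) (δ / 2 / P.L / 2) p x' :=
    fun hc => maj_exponent_reduce hc p x'
  -- split the row
  have hsplit : ∑ b : HiggsLattice.PBond P 0,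
        (κ₁ * Df b * K b.tgt + (κ₂ * Vf b.src + κ₁ * Df b) * K b.src + κ₃ * Vf b.tgt * K b.tgt)
      = κ₁ * ∑ b : HiggsLattice.PBond P 0, Df b * K b.tgt
        + κ₂ * ∑ b : HiggsLattice.PBond P 0, Vf b.src * K b.src
        + κ₁ * ∑ b : HiggsLattice.PBond P 0, Df b * K b.src
        + κ₃ * ∑ b : HiggsLattice.PBond P 0, Vf b.tgt * K b.tgt := by
    simp only [Finset.mul_sum, ← Finset.sum_add_distrib]
    exact Finset.sum_congr rfl fun b _ => by ring
  rw [hsplit]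
  -- each term
  have t1 : κ₁ * ∑ b : HiggsLattice.PBond P 0, Df b * K b.tgt
      ≤ maj P k ((P.d : ℝ) * (κ₁ * (Real.exp 1 * cK * cd * convK P N δ aK (av - 1)))) (aK + av - 1) (δ / 2 / P.L / 2) p x' := by
    have hc : 0 ≤ Real.exp 1 * cK * cd * convK P N δ aK (av - 1) := by positivity
    refine (mul_le_mul_of_nonneg_left (h1.trans (mul_le_mul_of_nonneg_left (hA hc) (Nat.cast_nonneg _))) hκ₁).trans (le_of_eq ?_)
    rw [mul_maj, mul_maj]; ring_nf
  have t3 : κ₁ * ∑ b : HiggsLattice.PBond P 0, Df b * K b.src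
      ≤ maj P k ((P.d : ℝ) * (κ₁ * (cK * cd * convK P N δ aK (av - 1)))) (aK + av - 1) (δ / 2 / P.L / 2) p x' := by
    have hc : 0 ≤ cK * cd * convK P N δ aK (av - 1) := by positivity
    refine (mul_le_mul_of_nonneg_left (h3.trans (mul_le_mul_of_nonneg_left (hA hc) (Nat.cast_nonneg _))) hκ₁).trans (le_of_eq ?_)
    rw [mul_maj, mul_maj]; ring_nf
  have t2 : κ₂ * ∑ b : HiggsLattice.PBond P 0, Vf b.src * K b.src
      ≤ maj P k (P.mesh k * ((P.d : ℝ) * (κ₂ * (cK * cv * convK P N δ aK av)))) (aK + av - 1) (δ / 2 / P.L / 2) p x' := by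
    have hc : 0 ≤ cK * cv * convK P N δ aK av := by positivity
    refine (mul_le_mul_of_nonneg_left (h2.trans (mul_le_mul_of_nonneg_left (hB hc) (Nat.cast_nonneg _))) hκ₂).trans (le_of_eq ?_)
    rw [mul_maj, mul_maj]; ring_nf
  have t4 : κ₃ * ∑ b : HiggsLattice.PBond P 0, Vf b.tgt * K b.tgt
      ≤ maj P k (P.mesh k * ((P.d : ℝ) * (κ₃ * (Real.exp 1 * cK * (Real.exp 1 * cv) * convK P N δ aK av))))
          (aK + av - 1) (δ / 2 / P.L / 2) p x' := by
    have hc : 0 ≤ Real.exp 1 * cK * (Real.exp 1 * cv) * convK P N δ aK av := by positivity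
    refine (mul_le_mul_of_nonneg_left (h4.trans (mul_le_mul_of_nonneg_left (hB hc) (Nat.cast_nonneg _))) hκ₃).trans (le_of_eq ?_)
    rw [mul_maj, mul_maj]; ring_nf
  have t5 : κ₄ * ∑ z : HiggsLattice.Site P 0, K z * (((P.L : ℝ) ^ (k * P.d))⁻¹ * ∑ u ∈ blockK k (blockIter k z), Vf u)
      ≤ maj P k (P.mesh k * (κ₄ * (cK * (blkK P N δ av * cv * (P.L : ℝ) ^ (av - (P.d : ℝ))) * convK P N (δ / 2 / P.L) aK av)))
          (aK + av - 1) (δ / 2 / P.L / 2) p x' := by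
    have hc : 0 ≤ cK * (blkK P N δ av * cv * (P.L : ℝ) ^ (av - (P.d : ℝ))) * convK P N (δ / 2 / P.L) aK av := by positivity
    refine (mul_le_mul_of_nonneg_left (h5.trans (hB' hc)) hκ₄).trans (le_of_eq ?_)
    rw [mul_maj]; ring_nf
  refine (add_le_add (add_le_add (add_le_add (add_le_add t1 t2) t3) t4) t5).trans (le_of_eq ?_)
  simp only [maj_add]
  unfold stepC
  ring_nf

end Step

end Literature.MathematicalPhysics.QuantumFieldTheory.Balaban1983to89.B3Op116MajorantStep
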